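import Summits.KontsevichZagierPeriods.Zeta5Search.Barrier.ConeGammaLemmaFBox

/-!
# ζ(5) search — BARRIER: kernel enclosures of the closed-form flow bound over direction boxes — SOUNDNESS of the checks

HONEST FRAMING (cell `pub-zeta5`): systematic search; no irrationality claim unless kernel-certified. Kernel ARITHMETIC
about the explicit elementary function `B_F(t) = x_top(t) − Σ_m ε_m x_m(t) log x_m(t)` of a real direction `t`
(file `ConeGammaLemmaFBox`: real side `bForm`, computable checker `boxCheck` / `pointLowerCheck` over the tree's
`NumericsMP.MI` fixed-point intervals). Nothing here is about `phi30`'s values at any direction, any `γ` of record,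
the cone's sup, C2 (OPEN), S-E (CONJECTURED), (TD_A) or `ζ(5)`; records in print UNMOVED. Theory seat cert-2 g34
(item «LEMMA F NUMERICS IN THE KERNEL — POINTS AND BOXES»), part 2/3.

* `dEnt`, `featEnc_sound` — the gradient form and what a successful feature recursion certifies (centre
  enclosure, gradient enclosures at every point of the box, the derivative of the entropy form along segments);
* `boxSummary_sound` — the summary `(bc, R)` encloses `B_F(t_c)` at the box centre and certifies the MEAN-VALUE
  inequality `B_F(t) ≤ B_F(t_c) + R/(2D·2^60)` at every real point of the box (1-D mean value theorem along the
  segment from the centre, `norm_image_sub_le_of_norm_deriv_le_segment_01'`, with the derivative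
  `Σ_i (t_i − t_c,i)·(c_top,i + Σ_m (−ε_m c_{m,i})(log x_m + 1))` from `featEnc_sound` and the coordinatewise
  enclosures of the gradient);
* **`bForm_le_of_boxCheck`** — `boxCheck F top D lo hi p q = true` ⇒ `B_F(t) ≤ p/q` on the whole box;
* **`le_bForm_of_pointCheck`** — `pointLowerCheck F top D pt p q = true` ⇒ `p/q ≤ B_F(pt/D)`;
* `pointCheck`, **`bForm_mem_of_pointCheck`** — the two-sided point interval in one evaluation.
-/

open Finset Set
open Literature.Analysis.ValidatedNumerics.NumericsMP

namespace Summit.KontsevichZagierPeriods.Zeta5Search.Barrier.ConeGamma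

namespace LemmaFBox

/-! ### Soundness, part 2: the feature recursion -/

/-- The gradient form enclosed by `Acc.g`: `Σ_{active (ε,c)} (−ε c_i)(log x_c(t) + 1)` (a feature is inactive on the
box iff `minNum = maxNum = 0`, i.e. it vanishes there). -/
noncomputable def dEnt (lo hi : List ℕ) : List (ℤ × List ℤ) → ℕ → (Fin 8 → ℝ) → ℝ
  | [], _, _ => 0
  | f :: F, i, t => (if minNum f.2 lo hi = 0 ∧ maxNum f.2 lo hi = 0 then 0
      else (-(f.1 * coef f.2 i) : ℝ) * (Real.log (featVal f.2 t) + 1)) + dEnt lo hi F i t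

/-- Entries of a `List.range 8` table. -/
theorem getD_map_range {α : Type*} (g : ℕ → α) (d : α) {i : ℕ} (hi : i < 8) :
    ((List.range 8).map g).getD i d = g i := by
  rw [List.getD_eq_getElem?_getD, List.getElem?_map, List.getElem?_range hi]; rfl

/-- A feature vanishing on the box. -/
theorem featVal_eq_zero_of_range {D : ℕ} (hD : 0 < D) {lo hi : List ℕ} {t : Fin 8 → ℝ} (h : t ∈ box D lo hi)
    {c : List ℤ} (h0 : minNum c lo hi = 0 ∧ maxNum c lo hi = 0) : featVal c t = 0 := by
  have h1 := minNum_le h c; have h2 := le_maxNum h c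
  rw [h0.1] at h1; rw [h0.2] at h2; push_cast at h1 h2
  have hD' : (0 : ℝ) < D := by exact_mod_cast hD
  nlinarith

/-- The affine parametrisation of a feature along a segment. -/
theorem featVal_segment (c : List ℤ) (u v : Fin 8 → ℝ) (θ : ℝ) :
    featVal c (u + θ • (v - u)) = featVal c u + θ * featVal c (v - u) := by
  rw [featVal_add, featVal_smul]

/-- `x_c(v − u)` coordinatewise. -/
theorem featVal_sub_eq_sum (c : List ℤ) (u v : Fin 8 → ℝ) :
    featVal c (v - u) = ∑ i : Fin 8, (v i - u i) * (coef c i : ℝ) := by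
  simp [featVal, mul_comm]

/-- **Soundness of the feature recursion**: a successful `featEnc` certifies (1) the centre enclosure, (2) the gradient
enclosures at every point of the box, (3) the derivative of the entropy form along every segment of the box. -/
theorem featEnc_sound {D : ℕ} (hD : 0 < D) {lo hi : List ℕ} (hle : ∀ i : Fin 8, lo.getD i 0 ≤ hi.getD i 0)
    {LD L2D : MI} (hLD : MI.mem SC (Real.log D) LD) (hL2D : MI.mem SC (Real.log ((2 * D : ℕ) : ℝ)) L2D) :
    ∀ (F : List (ℤ × List ℤ)) {acc : Acc}, featEnc D lo hi LD L2D F = some acc →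
      MI.mem SC (entF F (centre D lo hi)) acc.ec ∧
      (∀ t ∈ box D lo hi, ∀ i : Fin 8, MI.mem SC (dEnt lo hi F i t) (acc.g.getD i ⟨0, 0⟩)) ∧
      (∀ u ∈ box D lo hi, ∀ v ∈ box D lo hi, ∀ θ ∈ Icc (0 : ℝ) 1,
        HasDerivAt (fun θ : ℝ => entF F (u + θ • (v - u)))
          (-∑ i : Fin 8, (v i - u i) * dEnt lo hi F i (u + θ • (v - u))) θ)
  | [], acc, h => by
    simp only [featEnc, Option.some.injEq] at h
    subst h
    refine ⟨by simp [entF, MI.mem], fun t _ i => ?_, fun u _ v _ θ _ => ?_⟩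
    · rw [getD_map_range _ _ i.isLt]; simp [dEnt, MI.mem]
    · simp only [entF, dEnt, mul_zero, Finset.sum_const_zero, neg_zero]; exact hasDerivAt_const θ 0
  | f :: F, acc, h => by
    simp only [featEnc] at h
    split at h
    · simp at h
    rename_i acc' hacc'
    have IH := featEnc_sound hD hle hLD hL2D F hacc'
    -- analyse the step
    simp only [featStep] at h
    split_ifs at h with h0 hneg
    · -- the feature vanishes on the box
      simp only [Option.some.injEq] at h
      subst h
      refine ⟨?_, fun t ht i => ?_, fun u hu v hv θ hθ => ?_⟩
      · simp only [entF, featVal_eq_zero_of_range hD (centre_mem hD hle) h0, zero_mul, mul_zero, zero_add]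
        exact IH.1
      · simp only [dEnt, if_pos h0, zero_add]; exact IH.2.1 t ht i
      · have hz : ∀ θ' : ℝ, featVal f.2 (u + θ' • (v - u)) = 0 := by
          intro θ'
          have hu0 := featVal_eq_zero_of_range hD hu h0
          have hv0 := featVal_eq_zero_of_range hD hv h0
          rw [featVal_segment, featVal_sub, hu0, hv0]; ring
        simp only [entF, dEnt, if_pos h0, zero_add, hz, zero_mul, mul_zero]
        exact IH.2.2 u hu v hv θ hθ
    · -- active feature: `0 < A`
      push Not at hneg
      split at h
      case h_2 => simp at h
      rename_i LA LB LX hLA hLB hLX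
      simp only [Option.some.injEq] at h
      subst h
      have hLA' := MI.mem_logNat2 SC_pos hLA
      have hLB' := MI.mem_logNat2 SC_pos hLB
      have hLX' := MI.mem_logNat2 SC_pos hLX
      have hpos : ∀ t ∈ box D lo hi, 0 < featVal f.2 t := fun t ht => by
        have h1 := minNum_le ht f.2
        have hA : (0 : ℝ) < minNum f.2 lo hi := by exact_mod_cast hneg
        have hD' : (0 : ℝ) < D := by exact_mod_cast hD
        exact (mul_pos_iff_of_pos_right hD').mp (hA.trans_le h1)
      have hlog : ∀ t ∈ box D lo hi, MI.mem SC (Real.log (featVal f.2 t) + 1)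
          (((⟨LA.lo, LB.hi⟩ : MI).sub LD).add (MI.ofInt SC 1)) := fun t ht => by
        have := MI.mem_add (mem_log_of_range hD hneg hLA' hLB' hLD (minNum_le ht f.2) (le_maxNum ht f.2))
          (MI.mem_ofInt SC 1)
        simpa using this
      refine ⟨?_, fun t ht i => ?_, fun u hu v hv θ hθ => ?_⟩
      · simp only [entF]
        rw [add_comm]
        refine MI.mem_add IH.1 ?_
        have hX : 0 < minNum f.2 lo hi + maxNum f.2 lo hi := by
          have := minNum_add_maxNum hD lo hi f.2
          have hc := hpos _ (centre_mem hD hle)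
          have : (0 : ℝ) < (minNum f.2 lo hi : ℝ) + maxNum f.2 lo hi := by rw [this]; positivity
          exact_mod_cast this
        exact mem_centre_term hD hX hLX' hL2D (by push_cast; exact (minNum_add_maxNum hD lo hi f.2).symm)
      · rw [getD_map_range _ _ i.isLt]
        simp only [dEnt, if_neg h0]
        rw [add_comm]
        refine MI.mem_add (IH.2.1 t ht i) ?_
        have := MI.mem_mulInt (hlog t ht) (-(f.1 * coef f.2 i))
        have e : (-(f.1 * coef f.2 i) : ℝ) * (Real.log (featVal f.2 t) + 1) =
            (Real.log (featVal f.2 t) + 1) * ((-(f.1 * coef f.2 i) : ℤ) : ℝ) := by push_cast; ring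
        rw [e]; exact this
      · simp only [entF, dEnt, if_neg h0]
        have hx : featVal f.2 (u + θ • (v - u)) ≠ 0 := (hpos _ (segment_mem hu hv hθ)).ne'
        have hseg : HasDerivAt (fun θ' : ℝ => featVal f.2 (u + θ' • (v - u))) (featVal f.2 (v - u)) θ := by
          simp only [featVal_segment]
          simpa using ((hasDerivAt_id θ).mul_const (featVal f.2 (v - u))).const_add (featVal f.2 u)
        have h1 := ((Real.hasDerivAt_mul_log hx).comp θ hseg).const_mul (f.1 : ℝ)
        have h2 := IH.2.2 u hu v hv θ hθ
        have h3 : HasDerivAt (fun θ' : ℝ => (f.1 : ℝ) * (featVal f.2 (u + θ' • (v - u)) *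
            Real.log (featVal f.2 (u + θ' • (v - u)))) + entF F (u + θ' • (v - u)))
            ((f.1 : ℝ) * ((Real.log (featVal f.2 (u + θ • (v - u))) + 1) * featVal f.2 (v - u)) +
              -∑ i : Fin 8, (v i - u i) * dEnt lo hi F i (u + θ • (v - u))) θ := h1.add h2
        refine h3.congr_deriv ?_
        rw [featVal_sub_eq_sum, Finset.mul_sum, Finset.mul_sum, ← Finset.sum_neg_distrib, ← Finset.sum_neg_distrib,
          ← Finset.sum_add_distrib]
        exact Finset.sum_congr rfl fun i _ => by ring

/-! ### Soundness, part 3: the box summary, the mean-value bound, the two checks -/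

/-- What `boxOK` checks. -/
theorem boxOK_spec {D : ℕ} {lo hi : List ℕ} (h : boxOK D lo hi = true) :
    0 < D ∧ ∀ i : Fin 8, lo.getD i 0 ≤ hi.getD i 0 := by
  simp only [boxOK, Bool.and_eq_true, decide_eq_true_eq, List.all_eq_true, List.mem_range] at h
  exact ⟨h.1, fun i => h.2 i i.isLt⟩

/-- **Soundness of the box summary**: `bc` encloses `B_F(t_c)` and the mean-value inequality
`B_F(t) ≤ B_F(t_c) + R/(2D·SC)` holds at every point of the box. -/
theorem boxSummary_sound {F : List (ℤ × List ℤ)} {top : List ℤ} {D : ℕ} (hD : 0 < D) {lo hi : List ℕ}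
    (hle : ∀ i : Fin 8, lo.getD i 0 ≤ hi.getD i 0) {bc : MI} {R : ℤ}
    (h : boxSummary F top D lo hi = some (bc, R)) :
    MI.mem SC (bForm F top (centre D lo hi)) bc ∧
      ∀ t ∈ box D lo hi, bForm F top t ≤ bForm F top (centre D lo hi) + (R : ℝ) / (2 * D) / SC := by
  unfold boxSummary at h
  split at h
  case h_2 => simp at h
  rename_i LD L2D hLD hL2D
  split at h
  · simp at h
  rename_i acc hacc
  simp only [Option.some.injEq, Prod.mk.injEq] at h
  obtain ⟨hbc, hR⟩ := h
  have hS : (0 : ℝ) < SC := by exact_mod_cast SC_pos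
  have hD' : (0 : ℝ) < D := by exact_mod_cast hD
  obtain ⟨Hc, Hg, Hd⟩ := featEnc_sound hD hle (MI.mem_logNat2 SC_pos hLD) (MI.mem_logNat2 SC_pos hL2D) F hacc
  set tc := centre D lo hi with htc
  have htop : featVal top tc = ((minNum top lo hi + maxNum top lo hi : ℤ) : ℝ) / ((2 * D : ℕ) : ℝ) := by
    push_cast; rw [minNum_add_maxNum hD lo hi top, mul_div_cancel_right₀ _ (by positivity)]
  constructor
  · rw [← hbc, bForm, htop]
    exact MI.mem_sub (MI.mem_ofFrac SC _ (by omega)) Hc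
  intro t ht
  have htc_mem : tc ∈ box D lo hi := centre_mem hD hle
  -- the path and its derivative
  set φ : ℝ → ℝ := fun θ => bForm F top (tc + θ • (t - tc)) with hφ
  set C : ℝ := (R : ℝ) / (2 * D) / SC with hC
  have hderiv : ∀ θ ∈ Icc (0 : ℝ) 1, HasDerivAt φ
      (∑ i : Fin 8, (t i - tc i) * ((coef top i : ℝ) + dEnt lo hi F i (tc + θ • (t - tc)))) θ := by
    intro θ hθ
    have hseg : HasDerivAt (fun θ' : ℝ => featVal top (tc + θ' • (t - tc))) (featVal top (t - tc)) θ := by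
      simp only [featVal_segment]
      simpa using ((hasDerivAt_id θ).mul_const (featVal top (t - tc))).const_add (featVal top tc)
    have h := hseg.sub (Hd tc htc_mem t ht θ hθ)
    refine h.congr_deriv ?_
    rw [featVal_sub_eq_sum, sub_neg_eq_add, ← Finset.sum_add_distrib]
    exact Finset.sum_congr rfl fun i _ => by ring
  have hbound : ∀ θ ∈ Ico (0 : ℝ) 1,
      ‖∑ i : Fin 8, (t i - tc i) * ((coef top i : ℝ) + dEnt lo hi F i (tc + θ • (t - tc)))‖ ≤ C := by
    intro θ hθ
    have hθ' : θ ∈ Icc (0 : ℝ) 1 := Ico_subset_Icc_self hθ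
    have hmem := segment_mem htc_mem ht hθ'
    rw [Real.norm_eq_abs]
    refine (Finset.abs_sum_le_sum_abs _ _).trans ?_
    have hterm : ∀ i : Fin 8, |(t i - tc i) * ((coef top i : ℝ) + dEnt lo hi F i (tc + θ • (t - tc)))| ≤
        (((hi.getD i 0 : ℕ) : ℝ) - ((lo.getD i 0 : ℕ) : ℝ)) / (2 * D) *
          (((max |((acc.g.getD i ⟨0, 0⟩).add (MI.ofInt SC (coef top i))).lo|
            |((acc.g.getD i ⟨0, 0⟩).add (MI.ofInt SC (coef top i))).hi| : ℤ) : ℝ) / SC) := by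
      intro i
      rw [abs_mul]
      refine mul_le_mul (abs_sub_centre_le hD ht i) ?_ (abs_nonneg _) ?_
      · have hm := MI.mem_add (Hg _ hmem i) (MI.mem_ofInt SC (coef top i))
        rw [add_comm] at hm
        exact abs_le_of_mem hm
      · have := hle i
        have : ((lo.getD i 0 : ℕ) : ℝ) ≤ ((hi.getD i 0 : ℕ) : ℝ) := by exact_mod_cast this
        exact div_nonneg (by linarith) (by positivity)
    refine (Finset.sum_le_sum fun i _ => hterm i).trans (le_of_eq ?_)
    rw [hC, ← hR, sum8_eq_sum]; push_cast
    rw [Finset.sum_div, Finset.sum_div]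
    exact Finset.sum_congr rfl fun i _ => by field_simp
  have hmvt := norm_image_sub_le_of_norm_deriv_le_segment_01' (fun θ hθ => (hderiv θ hθ).hasDerivWithinAt) hbound
  have e1 : φ 1 = bForm F top t := by simp [hφ]
  have e0 : φ 0 = bForm F top tc := by simp [hφ]
  rw [e1, e0, Real.norm_eq_abs] at hmvt
  linarith [le_abs_self (bForm F top t - bForm F top tc)]

/-- **KERNEL BOX BOUND.** If `boxCheck F top D lo hi p q = true` then `B_F(t) = x_top(t) − E_F(t) ≤ p/q` for EVERY real
direction `t` of the box `lo_i ≤ D·t_i ≤ hi_i`. -/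
theorem bForm_le_of_boxCheck {F : List (ℤ × List ℤ)} {top : List ℤ} {D : ℕ} {lo hi : List ℕ} {p : ℤ} {q : ℕ}
    (h : boxCheck F top D lo hi p q = true) {t : Fin 8 → ℝ}
    (ht : ∀ i : Fin 8, ((lo.getD i 0 : ℕ) : ℝ) ≤ t i * D ∧ t i * D ≤ ((hi.getD i 0 : ℕ) : ℝ)) :
    bForm F top t ≤ (p : ℝ) / q := by
  simp only [boxCheck, Bool.and_eq_true, decide_eq_true_eq] at h
  obtain ⟨⟨hOK, hq⟩, h⟩ := h
  obtain ⟨hD, hle⟩ := boxOK_spec hOK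
  split at h
  case h_2 => simp at h
  rename_i bc R hsum
  rw [decide_eq_true_eq] at h
  obtain ⟨hc, hmv⟩ := boxSummary_sound hD hle hsum
  have hS : (0 : ℝ) < SC := by exact_mod_cast SC_pos
  have hD' : (0 : ℝ) < D := by exact_mod_cast hD
  have hq' : (0 : ℝ) < q := by exact_mod_cast hq
  have h1 := hmv t ht
  have h2 : bForm F top (centre D lo hi) ≤ (bc.hi : ℝ) / SC := by rw [le_div_iff₀ hS]; exact hc.2
  have h3 : ((bc.hi * (2 * (D : ℤ)) + R) * (q : ℤ) : ℝ) ≤ (p * (2 * (D : ℤ)) * (SC : ℤ) : ℝ) := by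
    exact_mod_cast h
  push_cast at h3
  have key : (bc.hi : ℝ) / SC + (R : ℝ) / (2 * D) / SC ≤ (p : ℝ) / q := by
    rw [show (bc.hi : ℝ) / SC + (R : ℝ) / (2 * D) / SC = ((bc.hi : ℝ) * (2 * D) + R) / (2 * D * SC) by
      field_simp, div_le_div_iff₀ (by positivity) hq']
    nlinarith
  linarith

/-- **KERNEL POINT LOWER BOUND.** If `pointLowerCheck F top D pt p q = true` then `p/q ≤ B_F(pt/D)`. -/
theorem le_bForm_of_pointCheck {F : List (ℤ × List ℤ)} {top : List ℤ} {D : ℕ} {pt : List ℕ} {p : ℤ} {q : ℕ}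
    (h : pointLowerCheck F top D pt p q = true) {t : Fin 8 → ℝ}
    (ht : ∀ i : Fin 8, t i * D = ((pt.getD i 0 : ℕ) : ℝ)) : (p : ℝ) / q ≤ bForm F top t := by
  simp only [pointLowerCheck, Bool.and_eq_true, decide_eq_true_eq] at h
  obtain ⟨⟨hOK, hq⟩, h⟩ := h
  obtain ⟨hD, hle⟩ := boxOK_spec hOK
  split at h
  case h_2 => simp at h
  rename_i bc R hsum
  rw [decide_eq_true_eq] at h
  obtain ⟨hc, -⟩ := boxSummary_sound hD hle hsum
  have hS : (0 : ℝ) < SC := by exact_mod_cast SC_pos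
  have hD' : (0 : ℝ) < D := by exact_mod_cast hD
  have hq' : (0 : ℝ) < q := by exact_mod_cast hq
  have e : t = centre D pt pt := by
    funext i; simp only [centre]; rw [eq_div_iff (by positivity), ← ht i]; ring
  rw [e]
  have h2 : (bc.lo : ℝ) / SC ≤ bForm F top (centre D pt pt) := by rw [div_le_iff₀ hS]; exact hc.1
  have h3 : ((p * (SC : ℤ) : ℤ) : ℝ) ≤ ((bc.lo * (q : ℤ) : ℤ) : ℝ) := by exact_mod_cast h
  push_cast at h3
  have key : (p : ℝ) / q ≤ (bc.lo : ℝ) / SC := by rw [div_le_div_iff₀ hq' hS]; linarith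
  linarith

/-- **Two-sided point check** (box = the point `pt/D`): `pl/q ≤ B_F(pt/D) ≤ pu/q` in ONE evaluation. -/
def pointCheck (F : List (ℤ × List ℤ)) (top : List ℤ) (D : ℕ) (pt : List ℕ) (pl pu : ℤ) (q : ℕ) : Bool :=
  boxOK D pt pt && decide (0 < q) &&
    match boxSummary F top D pt pt with
    | some (bc, _) => decide (pl * (SC : ℤ) ≤ bc.lo * (q : ℤ)) && decide (bc.hi * (q : ℤ) ≤ pu * (SC : ℤ))
    | none => false

/-- **KERNEL POINT INTERVAL.** If `pointCheck F top D pt pl pu q = true` then `pl/q ≤ B_F(pt/D) ≤ pu/q`. -/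
theorem bForm_mem_of_pointCheck {F : List (ℤ × List ℤ)} {top : List ℤ} {D : ℕ} {pt : List ℕ} {pl pu : ℤ}
    {q : ℕ} (h : pointCheck F top D pt pl pu q = true) {t : Fin 8 → ℝ}
    (ht : ∀ i : Fin 8, t i * D = ((pt.getD i 0 : ℕ) : ℝ)) :
    (pl : ℝ) / q ≤ bForm F top t ∧ bForm F top t ≤ (pu : ℝ) / q := by
  simp only [pointCheck, Bool.and_eq_true, decide_eq_true_eq] at h
  obtain ⟨⟨hOK, hq⟩, h⟩ := h
  obtain ⟨hD, hle⟩ := boxOK_spec hOK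
  split at h
  case h_2 => simp at h
  rename_i bc R hsum
  simp only [Bool.and_eq_true, decide_eq_true_eq] at h
  obtain ⟨hl, hu⟩ := h
  obtain ⟨hc, -⟩ := boxSummary_sound hD hle hsum
  have hS : (0 : ℝ) < SC := by exact_mod_cast SC_pos
  have hD' : (0 : ℝ) < D := by exact_mod_cast hD
  have hq' : (0 : ℝ) < q := by exact_mod_cast hq
  have e : t = centre D pt pt := by
    funext i; simp only [centre]; rw [eq_div_iff (by positivity), ← ht i]; ring
  rw [e]
  have h1 : (bc.lo : ℝ) / SC ≤ bForm F top (centre D pt pt) := by rw [div_le_iff₀ hS]; exact hc.1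
  have h2 : bForm F top (centre D pt pt) ≤ (bc.hi : ℝ) / SC := by rw [le_div_iff₀ hS]; exact hc.2
  have h3 : ((pl * (SC : ℤ) : ℤ) : ℝ) ≤ ((bc.lo * (q : ℤ) : ℤ) : ℝ) := by exact_mod_cast hl
  have h4 : ((bc.hi * (q : ℤ) : ℤ) : ℝ) ≤ ((pu * (SC : ℤ) : ℤ) : ℝ) := by exact_mod_cast hu
  push_cast at h3 h4
  constructor
  · have key : (pl : ℝ) / q ≤ (bc.lo : ℝ) / SC := by rw [div_le_div_iff₀ hq' hS]; linarith
    linarith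
  · have key : (bc.hi : ℝ) / SC ≤ (pu : ℝ) / q := by rw [div_le_div_iff₀ hS hq']; linarith
    linarith

end LemmaFBox

end Summit.KontsevichZagierPeriods.Zeta5Search.Barrier.ConeGamma
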